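import Summits.CriticalPhenomena.SAWScalingLimit.Theorems.SAWDevelopingMapObservableToSLETypeLadderCarvedReductionSqueezeOmegaOf
import Literature.Probability.RandomPlanarGeometry.CaratheodoryHalfPlaneProofs
import HarnessLib

/-!
# The outer sequence of the bundled limit data (piece (T-A′₂F outer of the data) of stub T-A′₂F
# `stub_carvedReduction_squeezeGeometry_domainsCoreF`)

Crux `SAWDevelopingMap.ObservableToSLE` (stmt-CriticalPhenomena-10472), line `six-class-type-ladder`,
stub T-A′₂F `stub_carvedReduction_squeezeGeometry_domainsCoreF`.  Landing target:
`Summits/CriticalPhenomena/SAWScalingLimit/Theorems/SAWDevelopingMapObservableToSLETypeLadderCarvedReductionSqueezeOuter.lean`.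

`SqueezeLimit.outer`: a `SqueezeOuter Λ rs` for a `SqueezeLimit Λ` — the zones
`Z_n = zoneAt (4εₙ) cₙ ⊆ Z'_n = zoneAt (2εₙ) (cₙ/2)` and regions `X_n = XAt (4εₙ)` built on the
bulk `Λ.Ω` (`SqueezeLimit.omega_facts`), with `ε₀` below the link scale of both sides
(`exists_links`, `isConnected_sideZone`) and `ρ/1024`, `c₀` below the collar scale of the local
boundary structure (`lbs_zoneAt`) and `infDist z∞ K / 2`; the hypotheses of `outerSeq` from
`…SqueezeZonesDef`, `…SqueezeZonesSeq` (density from `exists_near_mem_sideZone` and the exterior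
of the Schoenflies image `K = closure (D - τ)`), and the reach data from
`eventually_not_mem_closure_zoneAt`.
Registered carrier: `stub_carvedReduction_outer`.
-/

noncomputable section

open scoped Topology
open Filter Set Metric
open Literature.Probability.LatticeModels (HexVertex hexGraph hexCenter triEmbed Site)
open Literature.Probability.RandomPlanarGeometry
open UpperHalfPlane (upperHalfPlaneSet)

namespace Summit.CriticalPhenomena.SAWScalingLimit.Theorems.ObservableToSLE.TypeLadder

open Summit.CriticalPhenomena.SAWScalingLimit.Theorems.ObservableToSLER.BridgeGate

/-- The frontier of the Schoenflies image `f '' ball 0 1` lies in the closure of the exterior of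
`f '' closedBall 0 1`. -/
theorem frontier_image_ball_subset_closure_compl (f : ℂ ≃ₜ ℂ) :
    frontier (f '' ball 0 1) ⊆ closure (f '' closedBall (0 : ℂ) 1)ᶜ := by
  intro p hp
  rw [← f.image_frontier, frontier_ball (0 : ℂ) one_ne_zero] at hp
  obtain ⟨u, hu, rfl⟩ := hp
  have hu1 : ‖u‖ = 1 := by simpa using hu
  rw [Metric.mem_closure_iff]
  intro ε hε
  have hcont : ContinuousAt (fun t : ℝ => f (((1 + t : ℝ)) • u)) 0 := by fun_prop
  have hlim : Tendsto (fun t : ℝ => f (((1 + t : ℝ)) • u)) (𝓝[>] 0) (𝓝 (f u)) := by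
    have := hcont.tendsto; simp only [add_zero, one_smul] at this
    exact this.mono_left nhdsWithin_le_nhds
  have hev : ∀ᶠ t : ℝ in 𝓝[>] 0, dist (f (((1 + t : ℝ)) • u)) (f u) < ε := (tendsto_iff_dist_tendsto_zero.1 hlim).eventually (gt_mem_nhds hε)
  obtain ⟨t, ht, htpos⟩ := (hev.and self_mem_nhdsWithin).exists
  have ht0 : 0 < t := htpos
  refine ⟨f (((1 + t : ℝ)) • u), fun h => ?_, by rw [dist_comm]; exact ht⟩
  obtain ⟨w, hw, hfw⟩ := h
  have : w = ((1 + t : ℝ)) • u := f.injective hfw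
  rw [this, mem_closedBall, dist_zero_right, norm_smul, hu1, mul_one, Real.norm_eq_abs, abs_of_pos (by linarith)] at hw
  linarith

/-- **THE OUTER SEQUENCE OF THE LIMIT DATA**; see the module docstring. -/
theorem SqueezeLimit.outer {D : DobrushinDomain} {a b : ℝ → HexVertex} {δ : ℕ → ℝ} {S T : ℕ → ℕ → Set HexVertex}
    {n n' : ℕ → ℕ} {q q' : ℕ → HexVertex} {κ : ℕ → ℕ} {ρ R : ℝ} {N : ℕ}
    (Λ : SqueezeLimit D a b δ S T n n' q q' κ ρ R N) {rs : ℝ} {Uf' : Set ℂ} (hUf'c : IsPreconnected Uf')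
    (hUf'D : Uf' ⊆ D.carrier) (hUf'disj : ∀ i, Disjoint Uf' (closedBall (D.pt i) R))
    (hUf'big : D.carrier \ (⋃ i : Fin 2, ball (D.pt i) rs) ⊆ Uf') (hrs₀ : R + ρ ≤ rs)
    (hrs₁ : 2 * rs ≤ dist (D.pt 0) (D.pt 1)) (hrs₂ : 2 * R < rs) : Nonempty (SqueezeOuter Λ rs) := by
  obtain ⟨hΩo, hΩc, hwin, hΩE, hΩcc, hfar, hΩD, hfrΩ, hb₀, hΩX, hballs, hΩ0, hcellR, hVE, hEΩ⟩ :=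
    Λ.omega_facts hUf'c hUf'D hUf'disj hUf'big hrs₀ hrs₁
  have hρ := Λ.hρ
  have hs0 : Tendsto (fun j => δ (κ j)) atTop (𝓝 0) := Λ.s0.mono_right nhdsWithin_le_nhds
  -- `K = closure (D - τ)` and the far point
  set f : ℂ ≃ₜ ℂ := Λ.H.trans (Homeomorph.addRight (-Λ.τ)) with hfdef
  have hfsub : ∀ s : Set ℂ, f '' s = (fun z => z - Λ.τ) '' (Λ.H '' s) := fun s => by
    rw [image_image]
    refine image_congr fun z _ => ?_
    show Λ.H z + -Λ.τ = Λ.H z - Λ.τ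
    ring
  have hDτ : Λ.Dτ = f '' ball 0 1 := by rw [hfsub, Λ.hHball]; rfl
  have hKd : closure Λ.Dτ = f '' closedBall 0 1 := by
    rw [hfsub, Λ.hHcl]; exact closure_translate D.toJordanDomain Λ.τ
  have hKdc : IsCompact (closure Λ.Dτ) := by rw [hKd]; exact (isCompact_closedBall 0 1).image f.continuous
  have hKdne : (closure Λ.Dτ).Nonempty := ⟨_, subset_closure (hΩD hb₀)⟩
  have hKdcc : IsPreconnected (closure Λ.Dτ)ᶜ := by
    rw [hKd, ← f.image_compl]
    exact ((isConnected_compl_closedBall_zero zero_le_one).image f f.continuous.continuousOn).isPreconnected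
  obtain ⟨Rj, hRj⟩ := Λ.J.isBounded.subset_ball 0
  set zf : ℂ := ((max Rj 0 + 1 : ℝ) : ℂ) with hzfdef
  have hzfJ : zf ∉ Λ.J.carrier := fun h => by
    have := mem_ball_zero_iff.1 (hRj h)
    rw [hzfdef, Complex.norm_real, Real.norm_eq_abs, abs_of_pos (by positivity)] at this
    linarith [le_max_left Rj 0]
  have hEJ : Λ.E.carrier ⊆ Λ.J.carrier := fun z hz => (Λ.hEJ hz).1
  have hKdJ : closure Λ.Dτ ⊆ Λ.J.carrier := Λ.hDJ
  have hzfK : zf ∉ closure Λ.Dτ := fun h => hzfJ (hKdJ h)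
  have hzfE : zf ∉ Λ.E.carrier := fun h => hzfJ (hEJ h)
  have hzfd : 0 < infDist zf (closure Λ.Dτ) := (infDist_pos_iff_notMem_closure hKdne).1 (by rw [closure_closure]; exact hzfK)
  have hΩK : Λ.Ω ⊆ closure Λ.Dτ := hΩD.trans subset_closure
  have hballK : ∀ i : Fin 2, ball (Λ.Pv i) (ρ / 2) ⊆ closure Λ.Dτ := hballs
  -- the boxes and the ends
  have hbox : ∀ (i : Fin 2) (z : ℂ), |z.re - (Λ.Pv i).re| ≤ ρ / 64 → (Λ.Pv i).im - ρ / 128 ≤ z.im → z.im ≤ (Λ.Pv i).im →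
      z ∉ Λ.E.carrier := by
    have h0 := Λ.hEbox 0; have h1 := Λ.hEbox 1
    rw [Λ.hEpt0] at h0; rw [Λ.hEpt1] at h1
    exact Fin.forall_fin_two.2 ⟨h0, h1⟩
  have hbox' : ∀ (i : Fin 2) (z : ℂ), z ∈ gateRect (Λ.Pv i) ρ → z ∉ Λ.E.carrier := fun i z hz => hbox i z hz.1 hz.2.1 hz.2.2
  have hxx : ∀ i k, Λ.xx i k ∈ frontier Λ.J.carrier := fun i k => by
    fin_cases k
    · exact (Λ.hcross i).2.1
    · exact (Λ.hcross i).2.2.1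
  -- the local boundary structure
  obtain ⟨c₀', hc₀', hlbs⟩ := lbs_zoneAt (Ksp := Λ.Kspv) (cell := Λ.cellv) (conn := Λ.connv) (Ω := Λ.Ω) hρ hEJ Λ.hfrE Λ.hLcut hxx
    hKdc hKdne hKdcc hzfK hKdJ Λ.hFJ (fun i => Λ.hFD i) hbox
  -- the links and the scales
  obtain ⟨s₀S, hs₀S, hlinkS⟩ := exists_links (Ksp := Λ.KS) (C := Λ.CS) (Cc := Λ.CcS) (W := Λ.WS) (ϱ := Λ.ϱS) (ϱc := Λ.ϱcS)
    hρ Λ.hϱcS0 Λ.hCcS Λ.hWS Λ.hWKS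
  obtain ⟨s₀T, hs₀T, hlinkT⟩ := exists_links (Ksp := Λ.KT) (C := Λ.CT) (Cc := Λ.CcT) (W := Λ.WT) (ϱ := Λ.ϱT) (ϱc := Λ.ϱcT)
    hρ Λ.hϱcT0 Λ.hCcT Λ.hWT Λ.hWKT
  set ε₀ : ℝ := min (min s₀S s₀T / 4) (ρ / 1024) with hε₀
  have hε₀0 : 0 < ε₀ := lt_min (by positivity) (by positivity)
  have hε₀s : 4 * ε₀ ≤ min s₀S s₀T := by have := min_le_left (min s₀S s₀T / 4) (ρ / 1024); rw [← hε₀] at this; linarith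
  have hε₀ρ : ε₀ ≤ ρ / 1024 := min_le_right _ _
  set c₀ : ℝ := min c₀' (infDist zf (closure Λ.Dτ) / 2) with hc₀
  have hc₀0 : 0 < c₀ := lt_min hc₀' (by positivity)
  have hε := fun m => epsSeq_pos hε₀0 m
  have hc := fun m => epsSeq_pos hc₀0 m
  have hεle := fun m => epsSeq_le hε₀0.le m
  have hcle := fun m => epsSeq_le hc₀0.le m
  -- connectedness of the side zones for small shrinks
  have hside : ∀ σ : ℝ, 0 < σ → σ ≤ 4 * ε₀ → ∀ i : Fin 2,
      IsConnected (sideZone (Λ.Pv i) ρ (Λ.Kspv i) (Λ.Bdv i) (Λ.cellv i) (Λ.connv i) σ) := by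
    intro σ hσ hσ4
    have hσS : σ ≤ s₀S := by linarith [min_le_left s₀S s₀T]
    have hσT : σ ≤ s₀T := by linarith [min_le_right s₀S s₀T]
    refine Fin.forall_fin_two.2 ⟨?_, ?_⟩
    · exact isConnected_sideZone hρ (by linarith) Λ.hBS.2.1 Λ.hKS.2.1 Λ.hBS.2.2.2 ⟨_, Λ.hBS.2.2.1, Λ.hKS.2.2⟩
        (hlinkS σ hσ hσS).1 (hlinkS σ hσ hσS).2
    · exact isConnected_sideZone hρ (by linarith) Λ.hBT.2.1 Λ.hKT.2.1 Λ.hBT.2.2.2 ⟨_, Λ.hBT.2.2.1, Λ.hKT.2.2⟩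
        (hlinkT σ hσ hσT).1 (hlinkT σ hσ hσT).2
  -- the zones
  set Z : ℕ → Set ℂ := fun m => zoneAt Λ.Pv ρ Λ.Kspv Λ.Bdv Λ.cellv Λ.connv (closure Λ.Dτ) zf (4 * epsSeq ε₀ m) (epsSeq c₀ m) with hZ
  set Z' : ℕ → Set ℂ := fun m => zoneAt Λ.Pv ρ Λ.Kspv Λ.Bdv Λ.cellv Λ.connv (closure Λ.Dτ) zf (2 * epsSeq ε₀ m) (epsSeq c₀ m / 2) with hZ'
  set X : ℕ → Set ℂ := fun m => XAt Λ.Ω Λ.Pv ρ (4 * epsSeq ε₀ m) with hX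
  have hatt : ∀ (σ cc : ℝ), 0 < σ → σ ≤ 4 * ε₀ → 0 < cc → cc ≤ c₀ → ∀ z ∈ zoneAt Λ.Pv ρ Λ.Kspv Λ.Bdv Λ.cellv Λ.connv (closure Λ.Dτ) zf σ cc ∩ Λ.E.carrier,
      ∃ C : Set ℂ, IsOpen C ∧ IsPreconnected C ∧ z ∈ C ∧ C ⊆ zoneAt Λ.Pv ρ Λ.Kspv Λ.Bdv Λ.cellv Λ.connv (closure Λ.Dτ) zf σ cc ∧
        (C \ Λ.E.carrier).Nonempty := fun σ cc hσ hσ4 hcc hcc₀ =>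
    zoneAt_attached hρ (by linarith) (hside σ hσ hσ4) hbox' (by linarith [min_le_right c₀' (infDist zf (closure Λ.Dτ) / 2)]) hzfE
  have hXdisj := fun m => XSeq_disjoint (cell := Λ.cellv) (conn := Λ.connv) (E := Λ.E.carrier) (zf := zf) (c₀ := c₀) hΩ0 hΩK hwin
    hballK hρ hε₀0 (by linarith) hc₀0 m
  -- density for the kernel
  have hdense : ∀ (i : Fin 2) (k : Fin N) (p : ℂ), (∀ ℓ : Fin 3, |skewCoord ℓ (p - (Λ.cellv i k).1)| ≤ (Λ.cellv i k).2) →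
      ∀ r > (0 : ℝ), ∃ s > (0 : ℝ), ∃ y ∈ sideZone (Λ.Pv i) ρ (Λ.Kspv i) (Λ.Bdv i) (Λ.cellv i) (Λ.connv i) s, dist y p < r := by
    refine Fin.forall_fin_two.2 ⟨fun k p hp r hr => ?_, fun k p hp r hr => ?_⟩
    · exact exists_near_mem_sideZone (B := Λ.BS) hρ Λ.hϱS0 Λ.hϱcS0 Λ.hCcS Λ.hWS Λ.hWKS k hp hr
    · exact exists_near_mem_sideZone (B := Λ.BT) hρ Λ.hϱT0 Λ.hϱcT0 Λ.hCcT Λ.hWT Λ.hWKT k hp hr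
  have hfr' : frontier Λ.Ω ∩ Λ.E.carrier ⊆ (⋃ i : Fin 2, ⋃ k : Fin N,
      {z : ℂ | ∀ ℓ : Fin 3, |skewCoord ℓ (z - (Λ.cellv i k).1)| ≤ (Λ.cellv i k).2}) ∪ closure (closure Λ.Dτ)ᶜ := by
    rintro p ⟨hp, -⟩
    rcases hfrΩ hp with (hX | hX) | hfr
    · obtain ⟨k, hk⟩ := mem_iUnion.1 hX
      exact Or.inl (mem_iUnion.2 ⟨0, mem_iUnion.2 ⟨k, hk⟩⟩)
    · obtain ⟨k, hk⟩ := mem_iUnion.1 hX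
      exact Or.inl (mem_iUnion.2 ⟨1, mem_iUnion.2 ⟨k, hk⟩⟩)
    · refine Or.inr ?_
      rw [hKd]; rw [hDτ] at hfr
      exact frontier_image_ball_subset_closure_compl f hfr
  have hREM := frontier_subset_closure_iUnion_zone (P := Λ.Pv) (ρ := ρ) (Ksp := Λ.Kspv) (Bd := Λ.Bdv) (cell := Λ.cellv)
    (conn := Λ.connv) (K := closure Λ.Dτ) (zf := zf) (Ω := Λ.Ω) (ε₀ := ε₀) (c₀ := c₀) Λ.E.isOpen hfr' hdense hKdc hKdne hKdcc hzfK
  -- the outer sequence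
  have hwinE : ∀ i : Fin 2, ∃ W ∈ 𝓝 (Λ.E.pt i), W ∩ Λ.E.carrier ⊆ Λ.Ω := by
    have key : ∀ i : Fin 2, Λ.E.pt i = Λ.Pv i := Fin.forall_fin_two.2 ⟨Λ.hEpt0, Λ.hEpt1⟩
    intro i
    refine ⟨ball (Λ.E.pt i) (ρ / 128), ball_mem_nhds _ (by positivity), fun z hz => ?_⟩
    have h1 : z ∈ Λ.E.carrier ∩ ball (Λ.E.pt i) (ρ / 128) := ⟨hz.2, hz.1⟩
    rw [Λ.hEflat i, key i] at h1
    exact hwin i ⟨h1.1, ball_subset_ball (by linarith) h1.2⟩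
  obtain ⟨φ, hφ⟩ := MarkedDomain.exists_isChordalUniformizing_holds Λ.E
  obtain ⟨En, hEn, hmono, hsub, hker, hG, hΩEn, -, hAstar, -⟩ := outerSeq Λ.E φ hφ hΩo hΩc hΩE hb₀ hwinE hΩcc Z Z' X
    (fun m => zoneSeq_subset hε₀0.le hc₀0.le m) (zoneSeq'_monotone hε₀0.le hc₀0.le)
    (fun m => disjoint_closure_zoneAt hΩ0 hΩK (by linarith [hε m]) (by linarith [hc m]))
    (fun m => hatt _ _ (by linarith [hε m]) (by linarith [hεle m]) (hc m) (hcle m))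
    (fun m => hatt _ _ (by linarith [hε m]) (by linarith [hεle m]) (by linarith [hc m]) (by linarith [hcle m]))
    (fun m => zoneSeq_margin hε₀0 hc₀0 m) (fun m => isPreconnected_XAt hρ (by linarith [hε m]) hΩc hwin) (fun m => Or.inl hb₀)
    (fun m => XAt_subset hΩE (hVE _ (by linarith [hε m]) (by linarith [hεle m])))
    (fun m => (hXdisj m).1) (fun m => (hXdisj m).2)
    (fun m p hp => by
      obtain ⟨Nb, hNb, halt⟩ := hlbs (2 * epsSeq ε₀ m) (epsSeq c₀ m / 2) (by linarith [hε m]) (by linarith [hεle m])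
        (by linarith [hc m]) (by linarith [hcle m, min_le_left c₀' (infDist zf (closure Λ.Dτ) / 2)]) p hp
      refine ⟨Nb, hNb, halt.imp id fun h => ?_⟩
      rwa [show 2 * (2 * epsSeq ε₀ m) = 4 * epsSeq ε₀ m by ring] at h)
    hREM
  -- the persistence margins
  have hup : ∀ i : Fin 2, ∀ᶠ j in atTop, ∀ v : HexVertex, v ∉ S (κ j) (n (κ j)) ∪ T (κ j) (n' (κ j)) →
      dist (((δ (κ j) : ℝ) : ℂ) * hexCenter v - ((δ (κ j) : ℝ) : ℂ) * triEmbed (Λ.x j)) (Λ.Pv i) < ρ / 2 →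
        (Λ.Pv i).im < (((δ (κ j) : ℝ) : ℂ) * hexCenter v - ((δ (κ j) : ℝ) : ℂ) * triEmbed (Λ.x j)).im :=
    fun i => (Λ.hup i).mono fun j hj v hvU hd => hj v (mem_ball.2 hd) hvU
  have hsidefar : ∀ (i : Fin 2) (σ : ℝ), 0 < σ → ∀ᶠ j in atTop, ∀ v : HexVertex, v ∉ S (κ j) (n (κ j)) ∪ T (κ j) (n' (κ j)) → ∀ z : ℂ,
      dist z (((δ (κ j) : ℝ) : ℂ) * hexCenter v - ((δ (κ j) : ℝ) : ℂ) * triEmbed (Λ.x j)) ≤ σ / 2 →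
        z ∉ closure (sideZone (Λ.Pv i) ρ (Λ.Kspv i) (Λ.Bdv i) (Λ.cellv i) (Λ.connv i) σ) := by
    refine Fin.forall_fin_two.2 ⟨fun σ hσ => ?_, fun σ hσ => ?_⟩
    · exact eventually_not_mem_closure_sideZone (hup 0) (fun ε hε => (Λ.hKperS ε hε).mono fun j hj v hv => Or.inl (hj v hv))
        (fun ε hε => (Λ.hBperS ε hε).mono fun j hj v hv => Or.inl (hj v hv))
        (fun ε hε => (Λ.hpersS ε hε).mono fun j hj i v hv => Or.inl (hj i v hv))
        (fun ε hε => (Λ.hconnS ε hε).mono fun j hj i v hv => Or.inl (hj i v hv)) hσ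
    · exact eventually_not_mem_closure_sideZone (hup 1) (fun ε hε => (Λ.hKperT ε hε).mono fun j hj v hv => Or.inr (hj v hv))
        (fun ε hε => (Λ.hBperT ε hε).mono fun j hj v hv => Or.inr (hj v hv))
        (fun ε hε => (Λ.hpersT ε hε).mono fun j hj i v hv => Or.inr (hj i v hv))
        (fun ε hε => (Λ.hconnT ε hε).mono fun j hj i v hv => Or.inr (hj i v hv)) hσ
  refine ⟨{
    φ := φ, En := En, Zc := fun m => closure (Z' m ∩ Λ.E.carrier), tz := fun m => 2 * epsSeq ε₀ m, hφ := hφ,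
    hKf := fun k => ?_, hKfball := fun k z hz => ?_,
    hΩo := hΩo, hΩc := hΩc, hwin := hwin, hΩE := hΩE, hΩcc := hΩcc, hfar := hfar, hΩD := hΩD, hΩX := hΩX, hEΩ := hEΩ, hb₀ := hb₀,
    hEn := hEn, hmono := hmono, hsub := hsub, hker := hker, hAstar := hAstar, hΩEn := hΩEn,
    htz := fun m => ⟨by linarith [hε m], by linarith [hεle m]⟩,
    htz25 := fun m => (tendsto_order.1 hs0).2 _ (show (0 : ℝ) < 2 * epsSeq ε₀ m / 25 by linarith [hε m]) |>.mono fun j hj => by linarith,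
    hV := fun m i => Set.subset_sdiff.2 ⟨hVE _ (by linarith [hε m]) (by linarith [hεle m]) i, ?_⟩,
    hbase := fun i => hwin i (base_mem_window hρ),
    hGEn := hG, hΩG := fun m => window_subset_bulk hΩc.isPreconnected
      (fun z hz => ⟨hΩE hz, disjoint_left.1 (disjoint_closure_zoneAt hΩ0 hΩK (by linarith [hε m]) (by linarith [hc m])) hz⟩) hb₀,
    hZfar := fun m => ?_ }⟩
  · -- compact convex family
    induction k using Fin.addCases with
    | left i =>
      rw [SqueezeLimit.Kf, Fin.addCases_left]
      exact ⟨Metric.isCompact_of_isClosed_isBounded (isClosed_skewHexAbs _ _) ((isBounded_closedBall).subset fun z hz =>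
        mem_closedBall.2 (hcellR 0 i z hz)), convex_skewHexAbs _ _⟩
    | right i =>
      rw [SqueezeLimit.Kf, Fin.addCases_right]
      exact ⟨Metric.isCompact_of_isClosed_isBounded (isClosed_skewHexAbs _ _) ((isBounded_closedBall).subset fun z hz =>
        mem_closedBall.2 (hcellR 1 i z hz)), convex_skewHexAbs _ _⟩
  · induction k using Fin.addCases with
    | left i =>
      rw [SqueezeLimit.Kf, Fin.addCases_left] at hz
      exact mem_iUnion.2 ⟨0, mem_ball.2 (by linarith [hcellR 0 i z hz])⟩
    | right i =>
      rw [SqueezeLimit.Kf, Fin.addCases_right] at hz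
      exact mem_iUnion.2 ⟨1, mem_ball.2 (by linarith [hcellR 1 i z hz])⟩
  · -- the path component is off the swallowed closure
    have hdisj := disjoint_XAt_closure_zoneAt (cell := Λ.cellv) (conn := Λ.connv) (E := Λ.E.carrier) (zf := zf) hΩ0 hΩK hwin hballK hρ
      (σ := 2 * epsSeq ε₀ m) (c := epsSeq c₀ m / 2) (t := 2 * epsSeq ε₀ m) (by linarith [hε m]) le_rfl (by linarith [hεle m])
      (by linarith [hc m])
    exact hdisj.mono_left fun z hz => Or.inr (mem_iUnion.2 ⟨i, hz⟩)
  · -- the persistence margin at radius `25 δ_j`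
    set mm : ℝ := min (epsSeq ε₀ m) (epsSeq c₀ m / 8) with hmm
    have hmm0 : 0 < mm := lt_min (hε m) (by linarith [hc m])
    have h1 := eventually_not_mem_closure_zoneAt (P := Λ.Pv) (ρ := ρ) (Ksp := Λ.Kspv) (Bd := Λ.Bdv) (cell := Λ.cellv) (conn := Λ.connv)
      (K := closure Λ.Dτ) (zf := zf) (E := Λ.E.carrier) (D₀ := D.carrier) (τ := Λ.τ) rfl Λ.hτ hsidefar
      (σ := 2 * epsSeq ε₀ m) (c := epsSeq c₀ m / 2) (m := mm) (by linarith [hε m]) (by linarith [hc m])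
      (by linarith [min_le_left (epsSeq ε₀ m) (epsSeq c₀ m / 8)]) (by linarith [min_le_right (epsSeq ε₀ m) (epsSeq c₀ m / 8)])
    have h2 : ∀ᶠ j in atTop, 25 * δ (κ j) ≤ mm := by
      have := (tendsto_order.1 hs0).2 _ (show (0 : ℝ) < mm / 25 by positivity)
      exact this.mono fun j hj => by linarith
    filter_upwards [h1, h2] with j hj hj2 v hvU hvD z hz
    exact hj v hvU hvD z (hz.trans hj2)

/-- **Registered carrier `stub_carvedReduction_outer`** (crux item stmt-CriticalPhenomena-10472, stub T-A′₂F
`stub_carvedReduction_squeezeGeometry_domainsCoreF`, piece THE OUTER OF THE DATA): the frontier of a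
Schoenflies image of the ball lies in the closure of the exterior of the image of the closed ball. -/
theorem stub_carvedReduction_outer :
    ∀ f : ℂ ≃ₜ ℂ, frontier (f '' ball 0 1) ⊆ closure (f '' closedBall (0 : ℂ) 1)ᶜ :=
  fun f => frontier_image_ball_subset_closure_compl f

end Summit.CriticalPhenomena.SAWScalingLimit.Theorems.ObservableToSLE.TypeLadder

end
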